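import Summits.QuantumFields.QCD.Theorems.RobustYangMills.Negative.MixtureWitness

/-!
# `RobustYangMills` — negative lemma: the smallness clause (h3) is load-bearing; `W ≡ 0` is admissible

Third extract of `Summits/QuantumFields/QCD/Cruxes/RobustYangMills/Disproof.lean` (item
stmt-QuantumFields-13897); builds on `Negative/MixtureWitness.lean`.

* `RobustYangMillsNoSmall κ` — the crux body at decay rate `κ` with (h3) `NormLE κ η` deleted;
  `robustYangMillsNoSmall_false : ∀ κ, ¬ RobustYangMillsNoSmall κ`. Witnesses: the one-activity global
  perturbations `W¹ = (β₁ - β'_k) S_W` (pure Wilson at a fixed small `β₁`) and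
  `W^{mix} = -β'_k S_W - log(e^{-β₁ S_W} + Z_{β₁})` (`½ μ_{β₁} + ½ μ_0`): both satisfy (h1), (h2), (h4);
  the mixture has long-range order `¼⟨P⟩_{β₁}² ≥ m₀²/4` in the plaquette two-point function at every
  time separation, against the uniform lattice gap (iii′) (applied to both witnesses). So ANY proof of
  the crux must use (h3) quantitatively: (h1) ∧ (h2) ∧ (h4) do not constrain global (mean-field /
  mixture) activities at all.
* `WilsonConsequences`, `robustYangMills_imp_wilson` — `W ≡ 0` is admissible, hence the crux implies
  the Clay-type package (subsequential OS continuum limit with non-trivial non-Gaussian curvature,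
  `HasMassGap Δ`, `HasLatticeMassGap Δ`) for the PURE `SU(3)` Wilson theory along every scaling sequence
  and every a.f. coupling sequence (`β`-universality included; `tendsto_afBeta_zero_atTop`: such
  sequences are eventually non-negative, which is all (h2) needs).

Repair 2026-08-17 (full-build breakage): route `NestedDissectionSea` dropped the item `RobustYangMills`
(stmt-QuantumFields-13897) at rev 25 (2026-08-16T23:27Z; the route now carries the RG-level
`RobustYangMillsRG`), so the gate-written route file no longer declares the constant
`Summit.QuantumFields.QCD.Theses.NestedDissectionSea.RobustYangMills`, while this negative-lemma chain —
Theorems files, append-only, whose statement texts name it — still does ("Unknown identifier", full build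
of 2026-08-16T23:32Z). The item itself is unchanged and still filed, verbatim, as
`Theses.HeavyThresholdYMBridge.RobustYangMills` and `Theses.AdaptiveBlockFermions.RobustYangMills`. The
constant is therefore re-declared below under its ORIGINAL fully-qualified name with its ORIGINAL definiens
(the item's ledger signature, verbatim — so it is definitionally equal, by `rfl`, to the two live route
constants), in the route file's namespace and `open` context; it is NOT a route item (no `route_item`
attribute). Same device as `Theorems/ShorLocallyDarkMixedMarginalsDarkRefutation.lean` (QuantumAdvantage) and
`Theorems/DebrisQuantaRobustDecayQuantumRecord.lean` (AnomalousDissipation); all theorems are unchanged.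
-/

namespace Summit.QuantumFields.QCD.Theses.NestedDissectionSea

open scoped BigOperators Topology Manifold Classical MeasureTheory ProbabilityTheory Matrix InnerProductSpace ComplexConjugate ContinuousMap
open Filter Set Function TopologicalSpace MeasureTheory

/-- **Record of the route item `RobustYangMills`** = stmt-QuantumFields-13897 (ledger signature verbatim;
dropped from route `NestedDissectionSea` at rev 25, still filed as
`Theses.HeavyThresholdYMBridge.RobustYangMills` = `Theses.AdaptiveBlockFermions.RobustYangMills`, to which
this constant is definitionally equal; NOT a route item here): OPENNESS OF THE GAPPED `SU(3)` YANG–MILLS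
PHASE in the coupling-relative, sup-small, range-controlled quasi-local, reflection-positive,
lattice-symmetric action cone — there are `η₀ > 0` and `κ ≥ 0` such that for all scaling data, every
`N_f = 0` a.f. coupling sequence, every block scale `ℓ₀ > 0` and every admissible family `W`
((h1) lattice symmetry, (h2) reflection positivity, (h3) `‖W_{k,S}‖_{b_k,κ} ≤ η`, (h4) range control),
the perturbed lattice theories have a subsequential OS continuum limit with non-trivial non-Gaussian
curvature and mass gap `Δ`, a uniform lattice gap at the same `Δ`, and `κ`-Lipschitz dependence of the
lattice Schwinger functions on `W`. Re-declared only so that this negative-lemma chain keeps elaborating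
(see the module docstring). -/
def RobustYangMills : Prop :=
  open Literature.MathematicalPhysics.QuantumLattice Literature.MathematicalPhysics.AQFT Literature.MathematicalPhysics.QuantumFieldTheory in let G := ↥(Matrix.specialUnitaryGroup (Fin 3) ℂ); let ρ : G →* Matrix (Fin 3) (Fin 3) ℂ := fundamentalRep (Fin 3); let r₃ : LatticeRep G := ⟨3, ρ, continuous_fundamentalRep _, fundamentalRep_injective _, fundamentalRep_mem_unitaryGroup⟩; ∃ η₀ : ℝ, 0 < η₀ ∧ ∃ κ : ℝ, 0 ≤ κ ∧ ∀ (a : ℕ → ℝ) (L : ℕ → ℕ) (ha : ∀ k, 0 < a k) (ha₀ : Filter.Tendsto a Filter.atTop (nhds 0)) (haL : Filter.Tendsto (fun k => a k * L k) Filter.atTop Filter.atTop) (β' : ℕ → ℝ) (Λ' : ℝ), 0 < Λ' → Filter.Tendsto (fun k => β' k - afBeta 0 Λ' (a k)) Filter.atTop (nhds 0) → ∀ ℓ₀ : ℝ, 0 < ℓ₀ → let η : ℝ := η₀ / max 1 (afBeta 0 Λ' ℓ₀); let AdmAt : ((k : ℕ) → (S : ℕ) → QuasiLocalGaugePerturbation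 4 (2 * S + 1) G ⌊ℓ₀ / a k⌋₊) → ℕ → Prop := fun W k => ∀ S : ℕ, L k ≤ S → (∀ (v : Site 4 (2 * S + 1)) (U : GaugeConfig 4 (2 * S + 1) G), (W k S).total (torusConfigShift v U) = (W k S).total U) ∧ (∀ U : GaugeConfig 4 (2 * S + 1) G, (W k S).total (GaugeConfig.timeReflect U) = (W k S).total U) ∧ (∀ (π : Equiv.Perm (Fin 4)) (U : GaugeConfig 4 (2 * S + 1) G), (W k S).total (fun e => U (e.1 ∘ π, π.symm e.2)) = (W k S).total U) ∧ (W k S).IsReflectionPositive ρ (β' k) ∧ (W k S).NormLE κ η ∧ (∀ X : Finset (Site 4 (2 * S + 1)), X ∈ polymers ⌊ℓ₀ / a k⌋₊ → (∃ U : GaugeConfig 4 (2 * S + 1) G, (W k S).act X U ≠ 0) → ∀ y ∈ X, ∀ y' ∈ X, ∀ i : Fin 4, (y i - y' i).val ≤ ⌊ℓ₀ / a k⌋₊ * X.card ∨ (y' i - y i).val ≤ ⌊ℓ₀ / a k⌋₊ * X.card); ∀ W, (∀ᶠ k in Filter.atTop, AdmAt W k) → ∃ φ : ℕ → ℕ,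 StrictMono φ ∧ ∃ (c m : YMSpecies G → ℕ → ℝ) (T : OSData (YMSpecies G) 4) (Δ : ℝ), 0 < Δ ∧ (∀ n : ℕ, n ≠ 0 → ∀ (σ : Fin n → YMSpecies G) (f : Fin n → SchwartzMap (EuclideanSpace ℝ (Fin 4)) ℝ) (F : SchwartzMap (Fin n → EuclideanSpace ℝ (Fin 4)) ℂ), IsTensorOf F (fun i => ofRealTest (f i)) → IsOffDiagonal F → Filter.Tendsto (fun j : ℕ => ((perturbedLatticeSchwinger ρ (⟨a, ha, ha₀, β', L, haL, c, m⟩ : SpeciesScheme (YMSpecies G)) (fun k => W k (L k)) (fun s => s.F) (φ j) n σ f : ℝ) : ℂ)) Filter.atTop (nhds (T.schwinger n σ F))) ∧ T.IsNontrivial r₃.curvature ∧ T.IsNonGaussian r₃.curvature ∧ T.HasMassGap Δ ∧ (∀ A B : YMSpecies G, ∃ C : ℝ, ∀ᶠ k in Filter.atTop, ∀ S : ℕ, L k ≤ S → ∀ n : ℕ, n ≤ S → |(W k S).connectedCorr ρ (β' k) A.F B.F n| ≤ C * Real.exp (-(Δ * (a k * n)))) ∧ (∀ (n : ℕ) (σ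 : Fin n → YMSpecies G) (f : Fin n → SchwartzMap (EuclideanSpace ℝ (Fin 4)) ℝ), ∃ C : ℝ, ∀ᶠ k in Filter.atTop, ∀ W', AdmAt W' k → ∀ δ : ℝ, 0 ≤ δ → (∀ S : ℕ, L k ≤ S → (W k S - W' k S).NormLE κ δ) → |perturbedLatticeSchwinger ρ (⟨a, ha, ha₀, β', L, haL, c, m⟩ : SpeciesScheme (YMSpecies G)) (fun k => W k (L k)) (fun s => s.F) k n σ f - perturbedLatticeSchwinger ρ (⟨a, ha, ha₀, β', L, haL, c, m⟩ : SpeciesScheme (YMSpecies G)) (fun k => W' k (L k)) (fun s => s.F) k n σ f| ≤ C * δ)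

end Summit.QuantumFields.QCD.Theses.NestedDissectionSea

noncomputable section

open MeasureTheory Filter Topology
open scoped ENNReal ComplexOrder
open Literature.MathematicalPhysics.QuantumLattice Literature.MathematicalPhysics.AQFT
  Literature.MathematicalPhysics.QuantumFieldTheory

namespace Summit.QuantumFields.QCD.Theorems.RobustYangMills.Negative

/-! ## §4 LOAD-BEARING: the crux with the smallness clause (h3) deleted is FALSE -/

section NoSmall

/-- **The body of `RobustYangMills` at decay rate `κ` with hypothesis (h3)
`‖W_{k,S}‖_{b_k,κ} ≤ η` deleted** (and with it the now idle `η₀`, `η`; `κ` survives only in the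
Lipschitz clause (iv)): verbatim the crux `NestedDissectionSea.RobustYangMills`
(= `HeavyThresholdYMBridge.RobustYangMills` = `AdaptiveBlockFermions.RobustYangMills`,
item `stmt-QuantumFields-13897`; the crux is `∃ η₀ > 0, ∃ κ ≥ 0, body`) except that the
admissibility predicate keeps only (h1) lattice symmetry of the total, (h2) reflection
positivity, (h4) range control. -/
def RobustYangMillsNoSmall (κ : ℝ) : Prop :=
  let G := ↥(Matrix.specialUnitaryGroup (Fin 3) ℂ); let ρ : G →* Matrix (Fin 3) (Fin 3) ℂ := fundamentalRep (Fin 3); let r₃ : LatticeRep G := ⟨3, ρ, continuous_fundamentalRep _, fundamentalRep_injective _, fundamentalRep_mem_unitaryGroup⟩; ∀ (a : ℕ → ℝ) (L : ℕ → ℕ) (ha : ∀ k, 0 < a k) (ha₀ : Filter.Tendsto a Filter.atTop (nhds 0)) (haL : Filter.Tendsto (fun k => a k * L k) Filter.atTop Filter.atTop) (β' : ℕ → ℝ) (Λ' : ℝ), 0 < Λ' → Filter.Tendsto (fun k => β' k - afBeta 0 Λ' (a k)) Filter.atTop (nhds 0) → ∀ ℓ₀ : ℝ, 0 < ℓ₀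 → let AdmAt : ((k : ℕ) → (S : ℕ) → QuasiLocalGaugePerturbation 4 (2 * S + 1) G ⌊ℓ₀ / a k⌋₊) → ℕ → Prop := fun W k => ∀ S : ℕ, L k ≤ S → (∀ (v : Site 4 (2 * S + 1)) (U : GaugeConfig 4 (2 * S + 1) G), (W k S).total (torusConfigShift v U) = (W k S).total U) ∧ (∀ U : GaugeConfig 4 (2 * S + 1) G, (W k S).total (GaugeConfig.timeReflect U) = (W k S).total U) ∧ (∀ (π : Equiv.Perm (Fin 4)) (U : GaugeConfig 4 (2 * S + 1) G), (W k S).total (fun e => U (e.1 ∘ π, π.symm e.2)) = (W k S).total U) ∧ (W k S).IsReflectionPositive ρ (β' k) ∧ (∀ X : Finset (Site 4 (2 * S + 1)), X ∈ polymers ⌊ℓ₀ / a k⌋₊ → (∃ U : GaugeConfig 4 (2 * S + 1) G, (W k S).act X U ≠ 0) → ∀ y ∈ X, ∀ y' ∈ X, ∀ i : Fin 4, (y i - y' i).val ≤ ⌊ℓ₀ / a k⌋₊ * X.card ∨ (y' i - y i).val ≤ ⌊ℓ₀ / a k⌋₊ * X.card); ∀ W, (∀ᶠ k in Filter.atTop,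 AdmAt W k) → ∃ φ : ℕ → ℕ, StrictMono φ ∧ ∃ (c m : YMSpecies G → ℕ → ℝ) (T : OSData (YMSpecies G) 4) (Δ : ℝ), 0 < Δ ∧ (∀ n : ℕ, n ≠ 0 → ∀ (σ : Fin n → YMSpecies G) (f : Fin n → SchwartzMap (EuclideanSpace ℝ (Fin 4)) ℝ) (F : SchwartzMap (Fin n → EuclideanSpace ℝ (Fin 4)) ℂ), IsTensorOf F (fun i => ofRealTest (f i)) → IsOffDiagonal F → Filter.Tendsto (fun j : ℕ => ((perturbedLatticeSchwinger ρ (⟨a, ha, ha₀, β', L, haL, c, m⟩ : SpeciesScheme (YMSpecies G)) (fun k => W k (L k)) (fun s => s.F) (φ j) n σ f : ℝ) : ℂ)) Filter.atTop (nhds (T.schwinger n σ F))) ∧ T.IsNontrivial r₃.curvature ∧ T.IsNonGaussian r₃.curvature ∧ T.HasMassGap Δ ∧ (∀ A B : YMSpecies G, ∃ C : ℝ, ∀ᶠ k in Filter.atTop, ∀ S : ℕ, L k ≤ S → ∀ n : ℕ, n ≤ S → |(W k S).connectedCorr ρ (β' k) A.F B.F n| ≤ C * Real.exp (-(Δ *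 (a k * n)))) ∧ (∀ (n : ℕ) (σ : Fin n → YMSpecies G) (f : Fin n → SchwartzMap (EuclideanSpace ℝ (Fin 4)) ℝ), ∃ C : ℝ, ∀ᶠ k in Filter.atTop, ∀ W', AdmAt W' k → ∀ δ : ℝ, 0 ≤ δ → (∀ S : ℕ, L k ≤ S → (W k S - W' k S).NormLE κ δ) → |perturbedLatticeSchwinger ρ (⟨a, ha, ha₀, β', L, haL, c, m⟩ : SpeciesScheme (YMSpecies G)) (fun k => W k (L k)) (fun s => s.F) k n σ f - perturbedLatticeSchwinger ρ (⟨a, ha, ha₀, β', L, haL, c, m⟩ : SpeciesScheme (YMSpecies G)) (fun k => W' k (L k)) (fun s => s.F) k n σ f| ≤ C * δ)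

/-- **Any proof of `RobustYangMills` must use the smallness clause (h3)**: the crux with (h3)
deleted is false. Witnesses, for every `k` and every odd torus `2S+1`: the ONE-activity
perturbations carried by the polymer of ALL block corners (legal in D1's class; (h4) holds because
`2S+1 ≤ b_k · #corners`), with activity
`W¹(U) = (β₁ - β'_k) S_W(U)` (so `μ_{β'_k, W¹} = μ_{β₁}`, the Wilson theory at a FIXED small
coupling `β₁ > 0`) and `W^{mix}(U) = -β'_k S_W(U) - log(e^{-β₁ S_W(U)} + Z_{β₁})` (so
`μ_{β'_k, W^{mix}} = ½ μ_{β₁} + ½ μ_0`, `μ_0` = product Haar). Both are invariant under all lattice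
symmetries ((h1): `S_W` is) and reflection positive ((h2): odd-torus Osterwalder–Seiler
positivity of `μ_{β₁}` and `μ_0`, tree `wilsonExpectation_oddReflectionPositive`). For the
plaquette species `P` the mixture has LONG-RANGE ORDER:
`⟨P; τ_n P⟩_{mix} = ½ ⟨P; τ_n P⟩_{β₁} + ¼ ⟨P⟩_{β₁}²` (`⟨P⟩_0 = 0` by the centre twist,
independence of link-disjoint plaquettes under Haar), while the uniform lattice-gap clause
(iii') for `W¹` forces `⟨P; τ_S P⟩_{β₁, 2S+1} → 0` and for `W^{mix}` forces
`⟨P; τ_S P⟩_{mix} → 0` as `S → ∞` at fixed `k`; but `⟨P⟩_{β₁, 2S+1} ≥ m₀ > 0` uniformly in `S`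
(first-order strong-coupling expansion, tree `wilsonExpectation_plaquette_ge`). Contradiction.
So (h1), (h2), (h4) do not constrain global (mean-field / mixture) activities at all; the ENTIRE
locality and stability content of the admissible cone sits in the weighted sup-norm bound (h3). -/
theorem robustYangMillsNoSmall_false (κ : ℝ) : ¬ RobustYangMillsNoSmall κ := by
  intro h
  -- scaling data: `a_k = 1/(k+1)`, `L_k = (k+1)²`, `Λ' = ℓ₀ = 1`, `β'_k = afBeta 0 1 a_k`
  have hzero := SpeciesScheme.zero (YMSpecies SU3)
  set a : ℕ → ℝ := fun k => ((k : ℝ) + 1)⁻¹ with ha_def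
  set L : ℕ → ℕ := fun k => (k + 1) ^ 2 with hL_def
  have ha : ∀ k, 0 < a k := fun k => by positivity
  have ha₀ : Tendsto a atTop (𝓝 0) :=
    tendsto_inv_atTop_zero.comp (tendsto_natCast_atTop_atTop.atTop_add tendsto_const_nhds)
  have haL : Tendsto (fun k => a k * L k) atTop atTop := by
    have e : (fun k : ℕ => a k * (L k : ℝ)) = fun k : ℕ => (k : ℝ) + 1 := by
      funext k; simp only [ha_def, hL_def]; push_cast; field_simp
    rw [e]
    exact tendsto_natCast_atTop_atTop.atTop_add tendsto_const_nhds
  set β' : ℕ → ℝ := fun k => afBeta 0 1 (a k) with hβ'_def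
  have hβ' : Tendsto (fun k => β' k - afBeta 0 1 (a k)) atTop (𝓝 0) := by
    simp only [hβ'_def, sub_self]; exact tendsto_const_nhds
  have h1 := h a L ha ha₀ haL β' 1 one_pos hβ' 1 one_pos
  -- block sizes
  have hb : ∀ k, 1 ≤ ⌊(1 : ℝ) / a k⌋₊ := fun k => by
    rw [Nat.le_floor_iff (by positivity)]
    simp only [ha_def, one_div, inv_inv, Nat.cast_one]
    linarith [(k.cast_nonneg : (0 : ℝ) ≤ k)]
  have hL1 : ∀ k S, L k ≤ S → 1 ≤ S := fun k S hS => by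
    have : 1 ≤ L k := Nat.one_le_pow _ _ (Nat.succ_pos k)
    omega
  -- the strong-coupling data
  obtain ⟨β₁, hβ₁, m₀, hm₀, hmean⟩ := exists_plaquette_mean_lower_bound
  -- the two witnesses are admissible (for ALL k)
  obtain ⟨φ₁, -, c₁, mm₁, T₁, Δ₁, hΔ₁, -, -, -, -, hgap₁, -⟩ := h1
    (fun k S => globalPert (Lt := 2 * S + 1) ρ₃ continuous_ρ₃ ⌊(1 : ℝ) / a k⌋₊ (gOne (β' k) β₁)
      (continuous_gOne (β' k) β₁))
    (Eventually.of_forall fun k S hS =>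
      ⟨fun v U => total_globalPert_shift _ _ _ v U,
       fun U => total_globalPert_timeReflect _ _ _ U,
       fun π U => total_globalPert_perm _ _ _ π U,
       isReflectionPositive_one continuous_ρ₃ (hL1 k S hS) _ _ hβ₁.le,
       fun X _ hne y hy y' hy' i => rangeControl_globalPert (hb k) _ _ X hne y hy y' hy' i⟩)
  obtain ⟨φ₂, -, c₂, mm₂, T₂, Δ₂, hΔ₂, -, -, -, -, hgap₂, -⟩ := h1
    (fun k S => globalPert (Lt := 2 * S + 1) ρ₃ continuous_ρ₃ ⌊(1 : ℝ) / a k⌋₊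
      (gMix (β' k) β₁ (partitionFunction (d := 4) (L := 2 * S + 1) ρ₃ β₁).toReal)
      (continuous_gMix (β' k) β₁ _ ENNReal.toReal_nonneg))
    (Eventually.of_forall fun k S hS =>
      ⟨fun v U => total_globalPert_shift _ _ _ v U,
       fun U => total_globalPert_timeReflect _ _ _ U,
       fun π U => total_globalPert_perm _ _ _ π U,
       isReflectionPositive_mix continuous_ρ₃ (hL1 k S hS) _ _ hβ₁.le,
       fun X _ hne y hy y' hy' i => rangeControl_globalPert (hb k) _ _ X hne y hy y' hy' i⟩)
  obtain ⟨C₁, hC₁⟩ := hgap₁ P01 P01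
  obtain ⟨C₂, hC₂⟩ := hgap₂ P01 P01
  obtain ⟨k, hk₁, hk₂⟩ := (hC₁.and hC₂).exists
  -- abbreviations for the Wilson integrals at step (β₁, S) and (0, S)
  have key : ∀ S : ℕ, L k ≤ S → 3 ≤ S →
      m₀ ^ 2 / 4 ≤ C₂ * Real.exp (-(Δ₂ * (a k * S))) + 2⁻¹ * (C₁ * Real.exp (-(Δ₁ * (a k * S)))) := by
    intro S hLS h3S
    have hS1 : 1 ≤ S := by omega
    have e1 := hk₁ S hLS S le_rfl
    have e2 := hk₂ S hLS S le_rfl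
    rw [connectedCorr_one] at e1
    rw [connectedCorr_mix continuous_ρ₃] at e2
    -- zero-coupling facts and translation invariance
    have hz : ∫ U, P01.F (torusLift (2 * S + 1) U) ∂(wilsonMeasure (d := 4) (L := 2 * S + 1) ρ₃ 0) = 0 :=
      integral_P01_zero hS1
    have hdisj := Summit.QuantumFields.YangMills.Theorems.LatticeGapOnTrajectory.Negative.disjoint_torusSupports_of_time_bound
      P01.supp P01.supp 1 P01_supp_time P01_supp_time (S := 2 * S + 1) (n := S) (by omega) (by omega)
    have hcc0 := Summit.QuantumFields.YangMills.Theorems.LatticeGapOnTrajectory.Negative.latticeConnectedCorr_zero_coupling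
      ρ₃ (2 * S + 1) P01 P01 S hdisj
    unfold latticeConnectedCorr at e1 hcc0
    rw [hz, mul_zero, sub_eq_zero] at hcc0
    rw [hz, hcc0] at e2
    have hI := hmean S hS1
    set I := ∫ U, P01.F (torusLift (2 * S + 1) U) ∂(wilsonMeasure (d := 4) (L := 2 * S + 1) ρ₃ β₁)
    set J := ∫ U, P01.F (torusLift (2 * S + 1) U) *
        P01.F (configShift (-Pi.single 0 (S : ℤ)) (torusLift (2 * S + 1) U))
          ∂(wilsonMeasure (d := 4) (L := 2 * S + 1) ρ₃ β₁)
    have hsq : m₀ ^ 2 ≤ I ^ 2 := pow_le_pow_left₀ hm₀.le hI 2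
    have f1 := (abs_le.1 e1).1
    have f2 := (abs_le.1 e2).2
    nlinarith [f1, f2, hsq]
  -- the right-hand side tends to `0` as `S → ∞` (fixed `k`)
  have hlim : Tendsto (fun S : ℕ => C₂ * Real.exp (-(Δ₂ * (a k * S))) +
      2⁻¹ * (C₁ * Real.exp (-(Δ₁ * (a k * S))))) atTop (𝓝 0) := by
    have hx : ∀ Δ : ℝ, 0 < Δ → Tendsto (fun S : ℕ => Real.exp (-(Δ * (a k * S)))) atTop (𝓝 0) := by
      intro Δ hΔ
      refine Real.tendsto_exp_atBot.comp ?_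
      refine tendsto_neg_atTop_atBot.comp ?_
      exact Tendsto.const_mul_atTop hΔ (Tendsto.const_mul_atTop (ha k) tendsto_natCast_atTop_atTop)
    have := ((hx Δ₂ hΔ₂).const_mul C₂).add (((hx Δ₁ hΔ₁).const_mul C₁).const_mul 2⁻¹)
    simpa using this
  have hle : m₀ ^ 2 / 4 ≤ 0 :=
    ge_of_tendsto hlim (Filter.eventually_atTop.2 ⟨max (L k) 3, fun S hS =>
      key S (le_of_max_le_left hS) (le_of_max_le_right hS)⟩)
  nlinarith [hm₀]

end NoSmall

/-! ## §5 `W ≡ 0` is admissible: the crux contains the Clay-type statement for the Wilson action -/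

section ZeroAdmissible

/-- The pure-gauge two-loop profile diverges along every scaling sequence:
`afBeta 0 Λ a_k → +∞` as `a_k → 0⁺` (`Λ > 0`; `b₀, b₁ > 0` at `N_f = 0`). [folklore] -/
theorem tendsto_afBeta_zero_atTop {a : ℕ → ℝ} (ha : ∀ k, 0 < a k)
    (ha₀ : Filter.Tendsto a Filter.atTop (nhds 0)) {Λ : ℝ} (hΛ : 0 < Λ) :
    Filter.Tendsto (fun k => afBeta 0 Λ (a k)) Filter.atTop Filter.atTop := by
  have hu : Tendsto (fun k => 1 / (a k ^ 2 * Λ ^ 2)) atTop atTop := by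
    simp only [one_div]
    refine tendsto_inv_nhdsGT_zero.comp ?_
    refine tendsto_nhdsWithin_iff.2 ⟨?_, Eventually.of_forall fun k => ?_⟩
    · simpa using (ha₀.pow 2).mul_const (Λ ^ 2)
    · exact Set.mem_Ioi.2 (by have := ha k; positivity)
  have hlog := Real.tendsto_log_atTop.comp hu
  have hb0 : 0 < betaCoeff₀ 0 := by unfold betaCoeff₀; norm_num; positivity
  have hb1 : 0 < betaCoeff₁ 0 := by unfold betaCoeff₁; norm_num; positivity
  have hmain : Tendsto (fun k => 2 * betaCoeff₀ 0 * Real.log (1 / (a k ^ 2 * Λ ^ 2))) atTop atTop :=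
    Tendsto.const_mul_atTop (by positivity) hlog
  refine tendsto_atTop_mono' atTop ?_ hmain
  filter_upwards [hlog.eventually_ge_atTop 1] with k hk
  unfold afBeta
  have hll : 0 ≤ Real.log (Real.log (1 / (a k ^ 2 * Λ ^ 2))) := Real.log_nonneg hk
  have : 0 ≤ 2 * (betaCoeff₁ 0 / betaCoeff₀ 0) * Real.log (Real.log (1 / (a k ^ 2 * Λ ^ 2))) := by
    positivity
  linarith

/-- Hence every coupling sequence `β'` with `β'_k - afBeta 0 Λ a_k → 0` is eventually `≥ 0`. [folklore] -/
theorem eventually_nonneg_of_af {a : ℕ → ℝ} (ha : ∀ k, 0 < a k)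
    (ha₀ : Filter.Tendsto a Filter.atTop (nhds 0)) {β' : ℕ → ℝ} {Λ : ℝ} (hΛ : 0 < Λ)
    (hβ' : Filter.Tendsto (fun k => β' k - afBeta 0 Λ (a k)) Filter.atTop (nhds 0)) :
    ∀ᶠ k in Filter.atTop, 0 ≤ β' k := by
  have h : Tendsto (fun k => (β' k - afBeta 0 Λ (a k)) + afBeta 0 Λ (a k)) atTop atTop :=
    hβ'.add_atTop (tendsto_afBeta_zero_atTop ha ha₀ hΛ)
  simp only [sub_add_cancel] at h
  exact h.eventually_ge_atTop 0

/-- **What the crux says about the UNPERTURBED theory** (`W ≡ 0`) along the scaling data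
`(a, L)` and the coupling sequence `β'`: the `SU(3)` Wilson lattice theory has a subsequential continuum limit `T` (joint Schwinger functions
of all gauge-invariant species on `⁰𝒮`) with non-trivial non-Gaussian curvature, a mass gap
`Δ > 0` of the full Hamiltonian, and the uniform lattice gap `HasLatticeMassGap` at the same
`Δ` — Clay's Yang–Mills problem for `SU(3)` in the tree's rendering, plus `β`-universality. -/
def WilsonConsequences (a : ℕ → ℝ) (L : ℕ → ℕ) (ha : ∀ k, 0 < a k)
    (ha₀ : Filter.Tendsto a Filter.atTop (nhds 0))
    (haL : Filter.Tendsto (fun k => a k * L k) Filter.atTop Filter.atTop) (β' : ℕ → ℝ) : Prop :=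
  let G := ↥(Matrix.specialUnitaryGroup (Fin 3) ℂ); let ρ : G →* Matrix (Fin 3) (Fin 3) ℂ := fundamentalRep (Fin 3); let r₃ : LatticeRep G := ⟨3, ρ, continuous_fundamentalRep _, fundamentalRep_injective _, fundamentalRep_mem_unitaryGroup⟩;
    ∃ φ : ℕ → ℕ, StrictMono φ ∧ ∃ (c m : YMSpecies G → ℕ → ℝ) (T : OSData (YMSpecies G) 4) (Δ : ℝ),
      0 < Δ ∧
      (∀ n : ℕ, n ≠ 0 → ∀ (σ : Fin n → YMSpecies G) (f : Fin n → SchwartzMap (EuclideanSpace ℝ (Fin 4)) ℝ)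
        (F : SchwartzMap (Fin n → EuclideanSpace ℝ (Fin 4)) ℂ),
        IsTensorOf F (fun i => ofRealTest (f i)) → IsOffDiagonal F →
          Filter.Tendsto (fun j : ℕ => ((latticeSchwinger ρ
            (⟨a, ha, ha₀, β', L, haL, c, m⟩ : SpeciesScheme (YMSpecies G)) (fun s => s.F) (φ j) n σ f : ℝ) : ℂ))
            Filter.atTop (nhds (T.schwinger n σ F))) ∧
      T.IsNontrivial r₃.curvature ∧ T.IsNonGaussian r₃.curvature ∧ T.HasMassGap Δ ∧
      HasLatticeMassGap r₃ (⟨a, ha, ha₀, β', L, haL, c, m⟩ : SpeciesScheme (YMSpecies G)) Δ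

/-- **The crux implies the Clay-type statement for the unperturbed Wilson action**: `W ≡ 0` is
admissible — (h1) trivially, (h2) by odd-torus reflection positivity of the Wilson measure
(tree, PROVED: `wilsonExpectation_oddReflectionPositive`), (h3) `‖0‖ = 0 ≤ η`, (h4) vacuously —
so the conclusion applies to it; D1's `perturbedLatticeSchwinger_zero` / `connectedCorr_zero`
identify the perturbed objects with the tree's `latticeSchwinger` / `latticeConnectedCorr`.
Hence the crux is at least as strong as `SU(3)` Yang–Mills existence with OS axioms,
non-triviality and mass gap along (a subsequence of) EVERY a.f. Wilson scaling sequence; any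
disproof of it through `W ≡ 0` would disprove that. [folklore] -/
theorem robustYangMills_imp_wilson
    (hR : Summit.QuantumFields.QCD.Theses.NestedDissectionSea.RobustYangMills)
    (a : ℕ → ℝ) (L : ℕ → ℕ) (ha : ∀ k, 0 < a k) (ha₀ : Filter.Tendsto a Filter.atTop (nhds 0))
    (haL : Filter.Tendsto (fun k => a k * L k) Filter.atTop Filter.atTop) (β' : ℕ → ℝ) (Λ' : ℝ)
    (hΛ' : 0 < Λ') (hβ' : Filter.Tendsto (fun k => β' k - afBeta 0 Λ' (a k)) Filter.atTop (nhds 0)) :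
    WilsonConsequences a L ha ha₀ haL β' := by
  have hpos : ∀ᶠ k in Filter.atTop, 0 ≤ β' k := eventually_nonneg_of_af ha ha₀ hΛ' hβ'
  obtain ⟨η₀, hη₀, κ, -, h⟩ := hR
  have h1 := h a L ha ha₀ haL β' Λ' hΛ' hβ' 1 one_pos
  have hη : 0 ≤ η₀ / max 1 (afBeta 0 Λ' 1) := div_nonneg hη₀.le (le_trans zero_le_one (le_max_left _ _))
  have hL1 : ∀ᶠ k in atTop, 1 ≤ L k := by
    have h2 : ∀ᶠ k in atTop, (1 : ℝ) ≤ a k * L k := haL.eventually_ge_atTop 1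
    have h3 : ∀ᶠ k in atTop, a k ≤ 1 := (ha₀.eventually (gt_mem_nhds one_pos)).mono fun k hk => hk.le
    filter_upwards [h2, h3] with k hk hk'
    by_contra hcon
    push Not at hcon
    have : L k = 0 := by omega
    rw [this] at hk
    simp at hk
    linarith
  obtain ⟨φ, hφ, c, m, T, Δ, hΔ, hconv, hnt, hng, hgapT, hgapL, -⟩ := h1 (fun k S => 0) (by
    filter_upwards [hpos, hL1] with k hk hkL S hS
    refine ⟨fun v U => by simp, fun U => by simp, fun π U => by simp,
      isReflectionPositive_zero_odd (fundamentalRep (Fin 3)) (le_trans hkL hS) (continuous_fundamentalRep _) hk _,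
      QuasiLocalGaugePerturbation.normLE_zero hη, ?_⟩
    rintro X - ⟨U, hU⟩
    simp at hU)
  refine ⟨φ, hφ, c, m, T, Δ, hΔ, fun n hn σ f F hF hF' => ?_, hnt, hng, hgapT, fun A B => ?_⟩
  · have := hconv n hn σ f F hF hF'
    refine this.congr fun j => ?_
    exact congrArg (fun r : ℝ => (r : ℂ))
      (perturbedLatticeSchwinger_zero (fundamentalRep (Fin 3))
        (⟨a, ha, ha₀, β', L, haL, c, m⟩ : SpeciesScheme (YMSpecies SU3))
        (bs := fun k => ⌊(1 : ℝ) / a k⌋₊) (fun s => s.F) (φ j) n σ f)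
  · obtain ⟨C, hC⟩ := hgapL A B
    refine ⟨C, ?_⟩
    filter_upwards [hC] with k hk S hS n hn
    have := hk S hS n hn
    beta_reduce at this
    rwa [QuasiLocalGaugePerturbation.connectedCorr_zero] at this

end ZeroAdmissible

end Summit.QuantumFields.QCD.Theorems.RobustYangMills.Negative
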